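import Literature.AlgebraicGeometry.GroupSchemes.RelativeFrobeniusKernel
import Literature.AlgebraicGeometry.GroupSchemes.GroupSchemeKernelBaseChange
import Literature.AlgebraicGeometry.Limits.SliceBaseChange
import HarnessLib

/-!
# Base change of the Frobenius twist, of the relative Frobenius and of its kernel
# (SGA 3 VII_A 4.1 «`F_{X/S}` commute au changement de base»; Görtz–Wedhorn (4.7), Prop. 4.16)

Topic `AlgebraicGeometry/GroupSchemes`; namespace `Literature.AlgebraicGeometry.GroupSchemes.RelFrobenius` (continues ★
`RelativeFrobeniusOverBase` (O3a), ★ `RelativeFrobeniusKernel` (O3b)).  DEFINITIONS WITH BODIES (isomorphisms assembled from ★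
`Limits.pullbackFacIso` and ★ `GroupSchemeKernel.baseChangeIso`) and fully proved theorems: **no named fact, no `sorry`, no
instance, no notation**.  Cell `pub/hodgecm-mathlib`, programme P6 («MOD»), piece (d1), first half: the base-change law of
`X^{(q/S)}`, `F_{X/S}` and `Ker F_{G/S}`; the second half (the fibre over a field-valued point and the identification with
B-p12's `frobeniusTwistOver` ∕ `relFrobeniusOver`) is ★ `RelativeFrobeniusFibre`.

## Mathematics

`k = 𝔽_q` finite, `S` a `k`-scheme with `q`-Frobenius `F_S` (★ `frobeniusOver`), `X → S`, `X^{(q/S)} = X ×_{S,F_S} S`,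
`F_{X/S} : X → X^{(q/S)}` (O3a).  For a `k`-morphism `g : S' → S` one has `g F_{S'} = F_S g` (★ `frobeniusOver_comp`), so
`(X^{(q/S)})_{S'} = (X ×_{S,F_S} S) ×_S S' ≅ X ×_{S, g F_{S'}} S' ≅ (X_{S'}) ×_{S',F_{S'}} S' = (X_{S'})^{(q/S')}` (transitivity
of base change twice, [GortzWedhorn2020, Prop. 4.16]) — more generally base change along any commuting square of bases
(§0).  Under this isomorphism `(F_{X/S})_{S'} = F_{X_{S'}/S'}` (compare the projections to `X` — both are «absolute Frobenius,
then project» — and to `S'`); it respects the transported group laws when `X = G` is an `S`-group (a natural transformation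
of cartesian-monoidal functors is monoidal, Mathlib `NatTrans.IsMonoidal.of_cartesianMonoidalCategory`), hence
`(Ker F_{G/S})_{S'} ≅ Ker F_{G_{S'}/S'}` (kernels commute with base change, ★ `GroupSchemeKernel.baseChangeIso`, and are
unchanged by an isomorphism of the target, `kerCompIso`).  [SGA3I, VII_A 4.1: «la formation de `F_{X/S}` commute au
changement de base».]

## Contents (`k` finite; `S S' : SchemeOver k`, `g : S' ⟶ S`, `X G : Over S.left`, `[GrpObj G]`)
* §0 `pullbackFacObjIso_inv_left_fst_fst`, `_inv_left_snd` (inverse projections of ★ `pullbackFacObjIso`);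
  **`pullbackSquareIso φ g φ' g₁ h : Over.pullback φ ⋙ Over.pullback g₁ ≅ Over.pullback g ⋙ Over.pullback φ'`** for
  `g₁ ≫ φ = φ' ≫ g` (+ `_hom_app_left_fst_fst`, `_hom_app_left_fst_snd`, `_hom_app_left_snd`); `kerι_comp_eq_one_of_comp_iso{,'}`,
  **`kerCompIso f e f' h : Ker f ≅ Ker f'`** for `f ≫ e.hom = f'`, `e` an isomorphism of group objects (+ `_hom_comp_kerι`,
  `_inv_comp_kerι`).
* §1 `left_comp_frobeniusOver_left`, **`frobTwistBaseChangeIso g`** (natural in `X`), **`frobTwistBaseChangeObjIso g X :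
  (X^{(q/S)})_{S'} ≅ (X_{S'})^{(q/S')}`** (+ `_hom_left_twistFst_fst`, `_hom_left_twistFst_snd`),
  **`pullback_map_relFrobenius_comp`** (`(F_{X/S})_{S'} ≫ ≅ = F_{X_{S'}/S'}`), `frobTwistBaseChangeGrpIso` (+ `_hom_hom_hom`),
  `isMonHom_frobTwistBaseChangeObjIso_hom`, **`frobKernelBaseChangeIso g G : (Ker F_{G/S})_{S'} ≅ Ker F_{G_{S'}/S'}`**
  (+ `_hom_comp_kerι`).

HC_CM is proved only modulo the printed citations until rung 0 closes; this file changes no count.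

## References
* [SGA3I] M. Demazure, A. Grothendieck (eds.), *SGA 3, Tome I*, Exp. VII_A (P. Gabriel), 4.1.
* [GortzWedhorn2020] U. Görtz, T. Wedhorn, *Algebraic Geometry I* (2nd ed.), Section (4.7), Prop. 4.16, (4.15) ∕ Def. 4.45,
  Def. 4.24.
* [Hartshorne1977] R. Hartshorne, *Algebraic Geometry*, IV §2 Rem. 2.4.1 (naturality of the Frobenius).
-/

set_option autoImplicit false

noncomputable section

-- Compositions through `((Over.pullback f).obj X).left = pullback X.hom f` are definitional only above `instances`
-- transparency (as in Mathlib's `Over.pullback` API, ★ `Limits/SliceBaseChange` and ★ `RelativeFrobeniusOverBase`).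
set_option backward.isDefEq.respectTransparency false

universe u

open CategoryTheory CategoryTheory.Limits AlgebraicGeometry MonoidalCategory

namespace Literature.AlgebraicGeometry.GroupSchemes.RelFrobenius

open Literature.AlgebraicGeometry.Motives Literature.AlgebraicGeometry.Limits GroupSchemeKernel
open scoped MonObj Obj

/-! ## §0 Base change along a commuting square of bases; kernels along an isomorphism of the target -/

section Square

variable {S S₁ S' S'₁ : Scheme.{u}} (φ : S₁ ⟶ S) (g : S' ⟶ S) (φ' : S'₁ ⟶ S') (g₁ : S'₁ ⟶ S₁)
  (h : g₁ ≫ φ = φ' ≫ g)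

/-- Inverse of ★ `pullbackFacObjIso`, first projection: `(y, t) ↦ ((y, a' t), t) ↦ y`. [cite: GortzWedhorn2020, Section (4.7),
Prop. 4.16] -/
@[reassoc]
theorem pullbackFacObjIso_inv_left_fst_fst {T : Scheme.{u}} (a' : T ⟶ S₁) (a : T ⟶ S) (ha : a' ≫ φ = a)
    (Y : Over S) :
    (pullbackFacObjIso φ a' a ha Y).inv.left ≫ pullback.fst ((Over.pullback φ).obj Y).hom a' ≫ pullback.fst Y.hom φ =
      pullback.fst Y.hom a := by
  rw [← pullbackFacObjIso_hom_left_fst φ a' a ha Y, ← Category.assoc, ← Over.comp_left, Iso.inv_hom_id, Over.id_left,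
    Category.id_comp]

/-- Inverse of ★ `pullbackFacObjIso`, second projection: `(y, t) ↦ t`. [cite: GortzWedhorn2020, Section (4.7), Prop. 4.16] -/
@[reassoc]
theorem pullbackFacObjIso_inv_left_snd {T : Scheme.{u}} (a' : T ⟶ S₁) (a : T ⟶ S) (ha : a' ≫ φ = a) (Y : Over S) :
    (pullbackFacObjIso φ a' a ha Y).inv.left ≫ pullback.snd ((Over.pullback φ).obj Y).hom a' = pullback.snd Y.hom a := by
  rw [← pullbackFacObjIso_hom_left_snd φ a' a ha Y, ← Category.assoc, ← Over.comp_left, Iso.inv_hom_id, Over.id_left,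
    Category.id_comp]

/-- **Base change along a commuting square of bases**: for `g₁ ≫ φ = φ' ≫ g` (`S'₁ → S₁ → S` = `S'₁ → S' → S`), `(Y ×_{S,φ}
S₁) ×_{S₁} S'₁ ≅ Y ×_S S'₁ ≅ (Y ×_{S,g} S') ×_{S'} S'₁` naturally in `Y` — twice the transitivity of base change (★
`pullbackFacIso`, [GortzWedhorn2020, Prop. 4.16]).  Being a natural transformation between cartesian-monoidal functors it is
automatically monoidal (Mathlib `NatTrans.IsMonoidal.of_cartesianMonoidalCategory`). [cite: GortzWedhorn2020, Section (4.7),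
Prop. 4.16] -/
def pullbackSquareIso : Over.pullback φ ⋙ Over.pullback g₁ ≅ Over.pullback g ⋙ Over.pullback φ' :=
  pullbackFacIso φ g₁ (φ' ≫ g) h ≪≫ (pullbackFacIso g φ' (φ' ≫ g) rfl).symm

/-- First projection of `pullbackSquareIso`: `((y, s₁), s'₁) ↦ y` equals `((y, s'), s'₁) ↦ y` after the isomorphism. [cite:
GortzWedhorn2020, Section (4.7), Prop. 4.16] -/
@[reassoc]
theorem pullbackSquareIso_hom_app_left_fst_fst (Y : Over S) :
    ((pullbackSquareIso φ g φ' g₁ h).hom.app Y).left ≫ pullback.fst ((Over.pullback g).obj Y).hom φ' ≫ pullback.fst Y.hom g =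
      pullback.fst ((Over.pullback φ).obj Y).hom g₁ ≫ pullback.fst Y.hom φ := by
  simp only [pullbackSquareIso, Iso.trans_hom, Iso.symm_hom, NatTrans.comp_app, pullbackFacIso_hom_app,
    pullbackFacIso_inv_app, Over.comp_left, Category.assoc, pullbackFacObjIso_inv_left_fst_fst,
    pullbackFacObjIso_hom_left_fst]

/-- Middle projection of `pullbackSquareIso`: `((y, s₁), s'₁) ↦ φ' s'₁` is the `S'`-coordinate after the isomorphism. [cite:
GortzWedhorn2020, Section (4.7), Prop. 4.16] -/
@[reassoc]
theorem pullbackSquareIso_hom_app_left_fst_snd (Y : Over S) :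
    ((pullbackSquareIso φ g φ' g₁ h).hom.app Y).left ≫ pullback.fst ((Over.pullback g).obj Y).hom φ' ≫ pullback.snd Y.hom g =
      pullback.snd ((Over.pullback φ).obj Y).hom g₁ ≫ φ' := by
  have hc : pullback.fst ((Over.pullback g).obj Y).hom φ' ≫ pullback.snd Y.hom g =
      pullback.snd ((Over.pullback g).obj Y).hom φ' ≫ φ' := pullback.condition
  simp only [pullbackSquareIso, Iso.trans_hom, Iso.symm_hom, NatTrans.comp_app, pullbackFacIso_hom_app,
    pullbackFacIso_inv_app, Over.comp_left, Category.assoc, hc, pullbackFacObjIso_inv_left_snd_assoc,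
    pullbackFacObjIso_hom_left_snd_assoc]

/-- Last projection of `pullbackSquareIso`: it is a morphism over `S'₁`. [cite: GortzWedhorn2020, Section (4.7), Prop. 4.16] -/
@[reassoc]
theorem pullbackSquareIso_hom_app_left_snd (Y : Over S) :
    ((pullbackSquareIso φ g φ' g₁ h).hom.app Y).left ≫ pullback.snd ((Over.pullback g).obj Y).hom φ' =
      pullback.snd ((Over.pullback φ).obj Y).hom g₁ :=
  Over.w ((pullbackSquareIso φ g φ' g₁ h).hom.app Y)

end Square

section KerComp

variable {C : Type*} [Category C] [CartesianMonoidalCategory C] {G H H' : C} [GrpObj H] [GrpObj H']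
  (f : G ⟶ H) (e : H ≅ H') [IsMonHom e.hom] (f' : G ⟶ H') (hf' : f ≫ e.hom = f')
  [HasPullback f η[H]] [HasPullback f' η[H']]

omit [HasPullback f' η[H']] in
include hf' in
/-- `Ker f ↪ G` is killed by `f' = f ≫ e`. [cite: GortzWedhorn2020, (4.15) and Definition 4.45 (2)] -/
theorem kerι_comp_eq_one_of_comp_iso : kerι f ≫ f' = 1 := by
  subst hf'
  rw [← Category.assoc, kerι_comp, MonObj.one_comp]

omit [HasPullback f η[H]] in
include hf' in
/-- `Ker f' ↪ G` is killed by `f = f' ≫ e⁻¹`. [cite: GortzWedhorn2020, (4.15) and Definition 4.45 (2)] -/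
theorem kerι_comp_eq_one_of_comp_iso' : kerι f' ≫ f = 1 := by
  subst hf'
  have h1 : kerι (f ≫ e.hom) ≫ f = (kerι (f ≫ e.hom) ≫ f ≫ e.hom) ≫ e.inv := by
    simp only [Category.assoc, e.hom_inv_id, Category.comp_id]
  rw [h1, kerι_comp, MonObj.one_comp]

/-- **The kernel is unchanged by an isomorphism of the target**: `Ker f ≅ Ker (f ≫ e)` for an isomorphism of group objects `e
: H ≅ H'` (stated for any `f'` with `f ≫ e = f'`; both inclusions into `G` agree, `kerCompIso_hom_comp_kerι`). [cite:
GortzWedhorn2020, (4.15) and Definition 4.45 (2)] -/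
def kerCompIso : ker f ≅ ker f' where
  hom := kerLift (kerι f) (kerι_comp_eq_one_of_comp_iso f e f' hf')
  inv := kerLift (kerι f') (kerι_comp_eq_one_of_comp_iso' f e f' hf')
  hom_inv_id := ker_hom_ext (by simp only [Category.assoc, kerLift_ι, Category.id_comp])
  inv_hom_id := ker_hom_ext (by simp only [Category.assoc, kerLift_ι, Category.id_comp])

/-- `kerCompIso` commutes with the inclusions into `G`. [cite: GortzWedhorn2020, (4.15) and Definition 4.45 (2)] -/
@[reassoc]
theorem kerCompIso_hom_comp_kerι : (kerCompIso f e f' hf').hom ≫ kerι f' = kerι f :=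
  kerLift_ι _ (kerι_comp_eq_one_of_comp_iso f e f' hf')

/-- The same for the inverse. [cite: GortzWedhorn2020, (4.15) and Definition 4.45 (2)] -/
@[reassoc]
theorem kerCompIso_inv_comp_kerι : (kerCompIso f e f' hf').inv ≫ kerι f = kerι f' :=
  kerLift_ι _ (kerι_comp_eq_one_of_comp_iso' f e f' hf')

end KerComp

variable {k : Type u} [Field k] [Finite k]

/-! ## §1 Base change of the twist, of `F_{X/S}` and of `Ker F_{G/S}` along a `k`-morphism `g : S' → S` -/

section BaseChange

variable {S S' : SchemeOver k} (g : S' ⟶ S)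

/-- `g ∘ F_{S'} = F_S ∘ g` on underlying schemes (★ `frobeniusOver_comp`). [cite: Hartshorne1977, IV §2 Rem. 2.4.1] -/
theorem left_comp_frobeniusOver_left : g.left ≫ (frobeniusOver S).left = (frobeniusOver S').left ≫ g.left := by
  rw [← Over.comp_left, ← Over.comp_left, frobeniusOver_comp]

/-- **Base change of the Frobenius twist**: `(X^{(q/S)}) ×_S S' ≅ (X ×_S S')^{(q/S')}` naturally in the `S`-scheme `X`, i.e.
`Over.pullback F_S ⋙ Over.pullback g ≅ Over.pullback g ⋙ Over.pullback F_{S'}` (the square `g F_{S'} = F_S g`). [cite: SGA3I,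
VII_A 4.1] [cite: GortzWedhorn2020, Section (4.7), Prop. 4.16] -/
def frobTwistBaseChangeIso :
    Over.pullback (frobeniusOver S).left ⋙ Over.pullback g.left ≅
      Over.pullback g.left ⋙ Over.pullback (frobeniusOver S').left :=
  pullbackSquareIso (frobeniusOver S).left g.left (frobeniusOver S').left g.left (left_comp_frobeniusOver_left g)

variable (X : Over S.left)

/-- The component of `frobTwistBaseChangeIso` at `X`: `(X^{(q/S)})_{S'} ≅ (X_{S'})^{(q/S')}` over `S'`. [cite: SGA3I, VII_A
4.1] -/
def frobTwistBaseChangeObjIso :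
    (Over.pullback g.left).obj (frobTwist S X) ≅ frobTwist S' ((Over.pullback g.left).obj X) :=
  (frobTwistBaseChangeIso g).app X

/-- Projection to `X`: the isomorphism is `((x, s), s') ↦ ((x, s'), s')` — first coordinates agree. [cite: GortzWedhorn2020,
Section (4.7), Prop. 4.16] -/
@[reassoc]
theorem frobTwistBaseChangeObjIso_hom_left_twistFst_fst :
    (frobTwistBaseChangeObjIso g X).hom.left ≫ twistFst S' ((Over.pullback g.left).obj X) ≫ pullback.fst X.hom g.left =
      pullback.fst (frobTwist S X).hom g.left ≫ twistFst S X :=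
  pullbackSquareIso_hom_app_left_fst_fst _ _ _ _ _ X

/-- Projection to `S'` through `X ×_S S'`: it is `F_{S'}` of the `S'`-coordinate. [cite: GortzWedhorn2020, Section (4.7),
Prop. 4.16] -/
@[reassoc]
theorem frobTwistBaseChangeObjIso_hom_left_twistFst_snd :
    (frobTwistBaseChangeObjIso g X).hom.left ≫ twistFst S' ((Over.pullback g.left).obj X) ≫ pullback.snd X.hom g.left =
      pullback.snd (frobTwist S X).hom g.left ≫ (frobeniusOver S').left :=
  pullbackSquareIso_hom_app_left_fst_snd _ _ _ _ _ X

/-- **The relative Frobenius commutes with base change**: `(F_{X/S}) ×_S S' = F_{X_{S'}/S'}` under `frobTwistBaseChangeObjIso`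
(«`F_{X/S}` commute au changement de base»). [cite: SGA3I, VII_A 4.1] -/
theorem pullback_map_relFrobenius_comp :
    (Over.pullback g.left).map (relFrobenius S X) ≫ (frobTwistBaseChangeObjIso g X).hom =
      relFrobenius S' ((Over.pullback g.left).obj X) := by
  have h1 : ((Over.pullback g.left).map (relFrobenius S X)).left ≫ pullback.fst (frobTwist S X).hom g.left =
      pullback.fst X.hom g.left ≫ (relFrobenius S X).left := by
    simp only [Over.pullback_map_left, pullback.lift_fst]
  have h2 : ((Over.pullback g.left).map (relFrobenius S X)).left ≫ pullback.snd (frobTwist S X).hom g.left =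
      pullback.snd X.hom g.left := by
    simp only [Over.pullback_map_left, pullback.lift_snd]
  have hsq : twistFst S' ((Over.pullback g.left).obj X) ≫ pullback.snd X.hom g.left =
      (frobTwist S' ((Over.pullback g.left).obj X)).hom ≫ (frobeniusOver S').left :=
    twistFst_comp_hom S' ((Over.pullback g.left).obj X)
  apply frobTwist_hom_ext S'
  apply pullback.hom_ext
  · simp only [Over.comp_left, Category.assoc]
    rw [frobTwistBaseChangeObjIso_hom_left_twistFst_fst, ← Category.assoc, h1, Category.assoc,
      relFrobenius_left_comp_twistFst, relFrobenius_left_comp_twistFst_assoc, absFrob_eq_powEndo, absFrob_eq_powEndo]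
    exact (powEndo_comp _ _ _ _ _).symm
  · simp only [Over.comp_left, Category.assoc]
    rw [frobTwistBaseChangeObjIso_hom_left_twistFst_snd, ← Category.assoc, h2, hsq, relFrobenius_left_comp_hom_assoc]
    rfl

variable (G : Over S.left) [GrpObj G]

/-- **Base change of the twist AS GROUP SCHEMES**: for an `S`-group `G`, `(G^{(q/S)})_{S'} ≅ (G_{S'})^{(q/S')}` in `Grp (Over
S')` for the transported group laws (`Functor.mapGrpNatIso` of the monoidal `frobTwistBaseChangeIso`,
`Functor.mapGrpCompIso`). [cite: SGA3I, VII_A 4.1] -/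
def frobTwistBaseChangeGrpIso :
    (Over.pullback g.left).mapGrp.obj ((Over.pullback (frobeniusOver S).left).mapGrp.obj (Grp.mk G)) ≅
      (Over.pullback (frobeniusOver S').left).mapGrp.obj ((Over.pullback g.left).mapGrp.obj (Grp.mk G)) :=
  (Functor.mapGrpCompIso.symm ≪≫ Functor.mapGrpNatIso (frobTwistBaseChangeIso g) ≪≫ Functor.mapGrpCompIso).app
    (Grp.mk G)

/-- Its underlying `S'`-morphism is `frobTwistBaseChangeObjIso`. [cite: SGA3I, VII_A 4.1] -/
theorem frobTwistBaseChangeGrpIso_hom_hom_hom :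
    (frobTwistBaseChangeGrpIso g G).hom.hom.hom = (frobTwistBaseChangeObjIso g G).hom := by
  simp [-frobeniusOver_left, frobTwistBaseChangeGrpIso, frobTwistBaseChangeObjIso, Functor.mapGrpNatIso,
    Functor.mapGrpCompIso]
  exact Category.id_comp _

/-- `frobTwistBaseChangeObjIso` at an `S`-group is a homomorphism for the transported group laws (of `G_{S'}` twisted, resp.
of `G^{(q/S)}` base-changed). [cite: SGA3I, VII_A 4.1] -/
theorem isMonHom_frobTwistBaseChangeObjIso_hom : IsMonHom (frobTwistBaseChangeObjIso g G).hom := by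
  have h : IsMonHom (frobTwistBaseChangeGrpIso g G).hom.hom.hom := inferInstance
  rw [frobTwistBaseChangeGrpIso_hom_hom_hom] at h
  exact h

/-- **The kernel of the relative Frobenius commutes with base change**: `(Ker F_{G/S}) ×_S S' ≅ Ker F_{G_{S'}/S'}` over `S'`
(★ `GroupSchemeKernel.baseChangeIso`, then `pullback_map_relFrobenius_comp` through `kerCompIso`). [cite: SGA3I, VII_A 4.1]
[cite: GortzWedhorn2020, (4.15) and Definition 4.45 (2)] -/
def frobKernelBaseChangeIso :
    (Over.pullback g.left).obj (frobKernel S G) ≅ frobKernel S' ((Over.pullback g.left).obj G) :=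
  haveI := isMonHom_frobTwistBaseChangeObjIso_hom g G
  GroupSchemeKernel.baseChangeIso g.left (relFrobenius S G) ≪≫
    kerCompIso ((Over.pullback g.left).map (relFrobenius S G)) (frobTwistBaseChangeObjIso g G)
      (relFrobenius S' ((Over.pullback g.left).obj G)) (pullback_map_relFrobenius_comp g G)

/-- `frobKernelBaseChangeIso` commutes with the inclusions: followed by `Ker F_{G_{S'}/S'} ↪ G_{S'}` it is the base change of
`Ker F_{G/S} ↪ G`. [cite: GortzWedhorn2020, (4.15) and Definition 4.45 (2)] -/
@[reassoc]
theorem frobKernelBaseChangeIso_hom_comp_kerι :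
    (frobKernelBaseChangeIso g G).hom ≫ frobKernelι S' ((Over.pullback g.left).obj G) =
      (Over.pullback g.left).map (frobKernelι S G) := by
  rw [frobKernelBaseChangeIso, Iso.trans_hom, Category.assoc, kerCompIso_hom_comp_kerι]
  exact GroupSchemeKernel.baseChangeIso_hom_comp_kerι g.left (relFrobenius S G)

end BaseChange

end Literature.AlgebraicGeometry.GroupSchemes.RelFrobenius
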